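import Mathlib
import HarnessLib
import Literature.MathematicalPhysics.QuantumFieldTheory.WilsonPlaquetteWeakCouplingFloor
import Summits.Ventures.LatticeQCDFlow.Scaling.AutoregressiveGaugePlaquetteTVFloorAnyLink
import Summits.Ventures.LatticeQCDFlow.Scaling.AutoregressiveProposalKLPinsker

/-!
# LatticeQCDFlow / Scaling — AN EXTENSIVE TRAINING-LOSS FLOOR: every gauge link generated after its staple
# from a conditional blind at one of its endpoints adds at least `½⟨(1/N) Re tr U_p⟩_β²` to the forward
# relative entropy of the autoregressive model — `m` such links cost `≥ ½ m ⟨W₁ₓ₁⟩²`, at every volume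

HONEST FRAMING: exact (Metropolis-corrected) sampling algorithms for lattice gauge theory;
figures of merit are autocorrelation/cost numbers at stated couplings and volumes; no
continuum-physics claim.

Venture `LatticeQCDFlow` (cell pub-lqcd), topic `Scaling`, FANOUT row 30 (lean-1, GEN-20) — OUR WORK on
THEORY-2.md §4 row C5, the gauge assembly of `Scaling/AutoregressiveProposalKLPinsker` (training loss
`≥ ½Σ_k δ_k²`) with the cell's context floors: `Scaling/AutoregressiveGaugeVertexBlindProposal` (a
conditional blind at one endpoint of a link is no better than the flat Haar law),
`Scaling/AutoregressiveGaugePlaquetteTVFloorAnyLink` (given the other three links of a plaquette, the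
flat law is at `L¹` distance `≥ (1/N)∫Re tr ρ(U_p)e^{−βS_W}` from the exact conditional of ANY of its
links; less context, closer to flat) and the tree's plaquette positivity and
weak-coupling floor (`Literature/…/WilsonPlaquettePositivity`, `…/WilsonPlaquetteWeakCouplingFloor`).

## Setting

Wilson weight `F = e^{−βS_W}` on `(ℤ/L)^d`, `L ≥ 2`, compact `G`, continuous `ρ` into `N × N` matrices with
a central element acting by a scalar `ω ≠ 1`; `π = Haar^{⊗E}`.  An autoregressive block: a duplicate-free
list `l` of links in generation order with conditionals `q_a` (measurable, `0 < c_q ≤ q_a ≤ C_q`,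
normalised in `a`, not reading the later links of `l`); the hybrid / model
`H_l = (∏_k q_{a_k})·A_{s_0}F/Z`.  A sub-list `S` of the steps `(a_k, s_k)` of the order, each WITNESSED:
a plaquette `P_k = (x; i, j)` containing `a_k` — ANY of its four links — whose other three links are
generated before `a_k` (they lie off `a_k :: s_k`), and an endpoint `Y_k` of `a_k` such that `q_{a_k}`
ignores every other link at `Y_k`.  (In any order of all links every plaquette has a last link, so such
witnesses abound for an architecture blind at every link.)

## What is proved (all [ours]; assembled from the parents)

* (from `Scaling/AutoregressiveGaugePlaquetteTVFloorAnyLink.wilson_condGap_ge_plaquette_of_mem`) at a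
  witnessed step the conditional `L¹` error is `≥ (1/N)∫Re tr ρ(U_{P_k})·F dπ = Z·⟨(1/N)Re tr U_{P_k}⟩_β`.
* **`wilson_kl_arHybrid_ge_sum_sq_plaquette`** (`β > 0`, `|ω| = 1`, `N ≥ 1`) —
  `Σ_{k∈S} ⟨(1/N)Re tr U_{P_k}⟩_β² ≤ 2·∫(F/Z) log((F/Z)/H_l) dπ`.
* **`wilson_kl_arHybrid_ge_card_mul_linkBall_sq`** (unitary `ρ`, `N ≥ 1`, `d ≥ 2`, `β > 0`, any `r > 0`
  with `f(r) = 1 − 8r²/N + 2 log φ_ρ(r)/((d−1)Nβ) ≥ 0`) — **`|S|·f(r)²/2 ≤ ∫(F/Z) log((F/Z)/H_l) dπ`**: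
  the forward relative entropy (training loss less the entropy constant) of the model grows at least
  LINEARLY IN THE NUMBER OF WITNESSED LINKS, with a slope independent of the volume and tending to `½` as
  `β → ∞`.

READING (value-free): for SU(n), U(N), U(1) in every dimension, an autoregressive architecture whose
conditioners systematically miss one endpoint of the current link pays a training loss proportional to
the number of links it generates after their staples — extensive in the volume for any raster-type order
— while (`Scaling/AutoregressiveGaugeAcceptanceCeiling`) its acceptance is capped at `1 − ⟨W₁ₓ₁⟩/4` by any
one of them.  NOT CLAIMED: an extensive REJECTION bound for such architectures (only the loss is shown
extensive; see `Scaling/AutoregressiveProposalAffinityChain` for what a uniform deficit would give); the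
count of witnessed steps (every order of all links has `≥ L^d/3` of them for a model blind at every link:
`Scaling/AutoregressiveGaugeKLExtensiveAnyOrder`); the reverse relative entropy; sharp constants.  No `def`, no `sorry`, nothing cited as a fact beyond the tree.
-/

noncomputable section

namespace Summit.Ventures.LatticeQCDFlow.Theory2.Autoregressive

open MeasureTheory Function Set
open Literature.MathematicalPhysics.QuantumFieldTheory Literature.MathematicalPhysics.QuantumLattice
open Summit.Ventures.LatticeQCDFlow.Exactness
open scoped Matrix Matrix.Norms.Frobenius

section Wilson

variable {d L N : ℕ} {G : Type*} [Group G] [TopologicalSpace G] [IsTopologicalGroup G]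
  [CompactSpace G] [SecondCountableTopology G] [MeasurableSpace G] [BorelSpace G] [NeZero L]
  (ρ : G →* Matrix (Fin N) (Fin N) ℂ)

/-- **THE EXTENSIVE LOSS FLOOR, plaquette-mean form.**  `β > 0`, `N ≥ 1`, continuous `ρ` with a central
element acting by `ω ≠ 1`, `|ω| = 1`, `L ≥ 2`; an autoregressive block `l` (duplicate-free, conditionals
squeezed, normalised, not reading later links); a sub-list `S` of its steps, each with a witnessing
plaquette `P c ∋ c.1` (other three links generated before) and endpoint `Y c` of `c.1` at which `q_{c.1}`
is blind.  Then `Σ_{c∈S} ⟨(1/N)Re tr U_{P c}⟩_β² ≤ 2·KL(e^{−βS_W}/Z ‖ H_l)`. [ours] -/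
theorem wilson_kl_arHybrid_ge_sum_sq_plaquette [NeZero N] (hρ : Continuous ρ) (hL : 2 ≤ L)
    {z : G} {ω : ℂ} (hω : ρ z = ω • (1 : Matrix (Fin N) (Fin N) ℂ)) (hω1 : ‖ω‖ = 1) (hne : ω ≠ 1)
    {β : ℝ} (hβ : 0 < β)
    {q : Edge d L → GaugeConfig d L G → ℝ} (hqm : ∀ a, Measurable (q a)) {cq Cq : ℝ} (hcq : 0 < cq)
    (hqlo : ∀ a U, cq ≤ q a U) (hqhi : ∀ a U, q a U ≤ Cq)
    (hq1 : ∀ a U, ∫ v, q a (update U a v) ∂(haarProbability G) = 1)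
    (l : List (Edge d L)) (hl : l.Nodup)
    (hpw : l.Pairwise (fun a b => ∀ (U : GaugeConfig d L G) (v : G), q a (update U b v) = q a U))
    (S : List (Edge d L × List (Edge d L))) (hS : S.Sublist (l.zip l.tails.tail))
    (P : Edge d L × List (Edge d L) → Plaquette d L) (Y : Edge d L × List (Edge d L) → Site d L)
    (hP : ∀ c ∈ S, c.1 ∈ ({((P c).1, (P c).2.1.1), ((P c).1.shift (P c).2.1.1, (P c).2.1.2),
        ((P c).1.shift (P c).2.1.2, (P c).2.1.1), ((P c).1, (P c).2.1.2)} : Finset (Edge d L)))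
    (hPs : ∀ c ∈ S, c.2.toFinset ⊆ Finset.univ \
      {((P c).1, (P c).2.1.1), ((P c).1.shift (P c).2.1.1, (P c).2.1.2),
        ((P c).1.shift (P c).2.1.2, (P c).2.1.1), ((P c).1, (P c).2.1.2)})
    (hY : ∀ c ∈ S, c.1.1 = Y c ∨ c.1.1.shift c.1.2 = Y c)
    (hqB : ∀ c ∈ S, ∀ e : Edge d L, e.1 = Y c ∨ e.1.shift e.2 = Y c → e ≠ c.1 →
      ∀ (U : GaugeConfig d L G) (v : G), q c.1 (update U e v) = q c.1 U) :
    (S.map fun c => (wilsonExpectation ρ β (fun U : GaugeConfig d L G =>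
        (N : ℝ)⁻¹ * (ρ (plaquetteHolonomy U (P c).1 (P c).2.1.1 (P c).2.1.2)).trace.re)) ^ 2).sum ≤
      2 * ∫ U, Real.exp (-β * wilsonAction ρ U) /
            (∫ W, Real.exp (-β * wilsonAction ρ W) ∂Measure.pi (fun _ : Edge d L => haarProbability G)) *
          Real.log ((Real.exp (-β * wilsonAction ρ U) /
              ∫ W, Real.exp (-β * wilsonAction ρ W) ∂Measure.pi (fun _ : Edge d L => haarProbability G)) /
            ((l.map fun b => q b U).prod *
                coordAvg (haarProbability G) l.toFinset
                  (fun V : GaugeConfig d L G => Real.exp (-β * wilsonAction ρ V)) U /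
              ∫ W, Real.exp (-β * wilsonAction ρ W) ∂Measure.pi (fun _ : Edge d L => haarProbability G)))
        ∂Measure.pi (fun _ : Edge d L => haarProbability G) := by
  classical
  set μ := haarProbability G with hμ
  set π := Measure.pi (fun _ : Edge d L => μ) with hπ
  set F : GaugeConfig d L G → ℝ := fun U => Real.exp (-β * wilsonAction ρ U) with hF
  set Z : ℝ := ∫ W, F W ∂π with hZ
  obtain ⟨hFm, B, hFlo, hFhi⟩ := wilsonWeight_props (d := d) (L := L) ρ hρ β
  have hZpos : 0 < Z :=
    integral_exp_pos (Literature.Probability.LatticeModels.integrable_of_continuous_compactSpace _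
      (Real.continuous_exp.comp (continuous_const.mul (continuous_wilsonAction ρ hρ))))
  haveI : Fact (1 < L) := ⟨hL⟩
  have hq0 : ∀ a U, 0 ≤ q a U := fun a U => hcq.le.trans (hqlo a U)
  -- Pinsker along the order
  have hsum := sum_sq_condGap_le_two_mul_kl μ hqm hcq hqlo hqhi hq1 hFm (Real.exp_pos _) hFlo hFhi l hl hpw
  -- the sub-list of witnessed steps, termwise
  set g : Edge d L × List (Edge d L) → ℝ := fun c =>
    (∫ U, |coordAvg μ c.2.toFinset F U - q c.1 U * coordAvg μ (c.1 :: c.2).toFinset F U| ∂π) ^ 2 with hg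
  have hg0 : ∀ c ∈ l.zip l.tails.tail, 0 ≤ g c := fun c _ => sq_nonneg _
  have hsub : (S.map g).sum ≤ ((l.zip l.tails.tail).map g).sum :=
    (hS.map g).sum_le_sum (fun x hx => by
      obtain ⟨c, hc, rfl⟩ := List.mem_map.1 hx
      exact hg0 c hc)
  have hterm : ∀ c ∈ S, (wilsonExpectation ρ β (fun U : GaugeConfig d L G =>
      (N : ℝ)⁻¹ * (ρ (plaquetteHolonomy U (P c).1 (P c).2.1.1 (P c).2.1.2)).trace.re)) ^ 2 ≤
        Z⁻¹ ^ 2 * g c := by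
    intro c hc
    have hkl : (P c).2.1.1 ≠ (P c).2.1.2 := ne_of_lt (P c).2.2
    -- the plaquette mean is `N⁻¹ X / Z ≥ 0`
    have hpos := wilsonExpectation_re_trace_plaquette_pos (d := d) (L := L) ρ hρ hω hω1 hne hβ (P c).1 hkl
    rw [wilsonExpectation_eq_integral_div ρ hρ] at hpos ⊢
    set X : ℝ := ∫ U, (ρ (plaquetteHolonomy U (P c).1 (P c).2.1.1 (P c).2.1.2)).trace.re * F U ∂π with hX
    have hnum : ∫ U, (N : ℝ)⁻¹ * (ρ (plaquetteHolonomy U (P c).1 (P c).2.1.1 (P c).2.1.2)).trace.re * F U ∂π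
        = (N : ℝ)⁻¹ * X := by
      rw [hX, ← integral_const_mul]
      refine integral_congr_ae (ae_of_all _ fun U => ?_)
      ring
    rw [hnum]
    have hX0 : 0 ≤ X := by
      have : 0 < X / Z := hpos
      exact (div_pos_iff_of_pos_right hZpos).1 this |>.le
    -- the linear floor at this step
    have hlin := wilson_condGap_ge_plaquette_of_mem (d := d) (L := L) ρ hρ hL hω hne β (P c) (hP c hc)
      (hPs c hc) (hqm c.1) (hq0 c.1) (hqhi c.1) (hq1 c.1) (hY c hc) (hqB c hc)
    have hlin' : (N : ℝ)⁻¹ * X ≤ ∫ U, |coordAvg μ c.2.toFinset F U -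
        q c.1 U * coordAvg μ (c.1 :: c.2).toFinset F U| ∂π := by
      rw [List.toFinset_cons]; exact hlin
    have h0 : 0 ≤ (N : ℝ)⁻¹ * X := mul_nonneg (inv_nonneg.2 (Nat.cast_nonneg N)) hX0
    have hsq : ((N : ℝ)⁻¹ * X) ^ 2 ≤ g c := pow_le_pow_left₀ h0 hlin' 2
    calc ((N : ℝ)⁻¹ * X / Z) ^ 2 = Z⁻¹ ^ 2 * ((N : ℝ)⁻¹ * X) ^ 2 := by rw [div_eq_mul_inv]; ring
      _ ≤ Z⁻¹ ^ 2 * g c := mul_le_mul_of_nonneg_left hsq (sq_nonneg _)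
  have hS' : (S.map fun c => (wilsonExpectation ρ β (fun U : GaugeConfig d L G =>
      (N : ℝ)⁻¹ * (ρ (plaquetteHolonomy U (P c).1 (P c).2.1.1 (P c).2.1.2)).trace.re)) ^ 2).sum ≤
        (S.map fun c => Z⁻¹ ^ 2 * g c).sum := List.sum_le_sum hterm
  rw [List.sum_map_mul_left] at hS'
  -- assemble: `Σ_S ≤ Z⁻² Σ_zip g ≤ Z⁻² · 2 Z² KL = 2 KL`
  have hkey : Z⁻¹ ^ 2 * ((l.zip l.tails.tail).map g).sum ≤ Z⁻¹ ^ 2 * (2 * Z ^ 2 * ∫ U, F U / Z *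
      Real.log ((F U / Z) / ((l.map fun b => q b U).prod * coordAvg μ l.toFinset F U / Z)) ∂π) :=
    mul_le_mul_of_nonneg_left hsum (sq_nonneg _)
  have e : Z⁻¹ ^ 2 * (2 * Z ^ 2 * ∫ U, F U / Z *
      Real.log ((F U / Z) / ((l.map fun b => q b U).prod * coordAvg μ l.toFinset F U / Z)) ∂π)
      = 2 * ∫ U, F U / Z *
      Real.log ((F U / Z) / ((l.map fun b => q b U).prod * coordAvg μ l.toFinset F U / Z)) ∂π := by
    field_simp
  rw [e] at hkey
  exact hS'.trans ((mul_le_mul_of_nonneg_left hsub (sq_nonneg _)).trans hkey)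

/-- **THE EXTENSIVE LOSS FLOOR, THE VOLUME-UNIFORM NUMBER.**  Under the hypotheses of
`wilson_kl_arHybrid_ge_sum_sq_plaquette` with `ρ` unitary and `d ≥ 2`, for every `r > 0` such that the
tree's weak-coupling floor `f(r) = 1 − 8r²/N + 2 log φ_ρ(r)/((d−1)Nβ)` is non-negative
(`φ_ρ(r) = Haar{‖ρ(g) − 1‖ ≤ r}`):  `|S|·f(r)²/2 ≤ KL(e^{−βS_W}/Z ‖ H_l)` — each witnessed link costs at
least `f(r)²/2` nats of training loss, independently of the volume. [ours] -/
theorem wilson_kl_arHybrid_ge_card_mul_linkBall_sq [NeZero N] (hd : 2 ≤ d) (hN : 1 ≤ N) (hρ : Continuous ρ)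
    (hρU : ∀ g, ρ g ∈ Matrix.unitaryGroup (Fin N) ℂ) (hL : 2 ≤ L)
    {z : G} {ω : ℂ} (hω : ρ z = ω • (1 : Matrix (Fin N) (Fin N) ℂ)) (hω1 : ‖ω‖ = 1) (hne : ω ≠ 1)
    {β : ℝ} (hβ : 0 < β) {r : ℝ} (hr : 0 < r)
    (hf : 0 ≤ 1 - 8 * r ^ 2 / N +
      2 * Real.log ((haarProbability G).real {g : G | ‖ρ g - 1‖ ≤ r}) / (((d : ℝ) - 1) * N * β))
    {q : Edge d L → GaugeConfig d L G → ℝ} (hqm : ∀ a, Measurable (q a)) {cq Cq : ℝ} (hcq : 0 < cq)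
    (hqlo : ∀ a U, cq ≤ q a U) (hqhi : ∀ a U, q a U ≤ Cq)
    (hq1 : ∀ a U, ∫ v, q a (update U a v) ∂(haarProbability G) = 1)
    (l : List (Edge d L)) (hl : l.Nodup)
    (hpw : l.Pairwise (fun a b => ∀ (U : GaugeConfig d L G) (v : G), q a (update U b v) = q a U))
    (S : List (Edge d L × List (Edge d L))) (hS : S.Sublist (l.zip l.tails.tail))
    (P : Edge d L × List (Edge d L) → Plaquette d L) (Y : Edge d L × List (Edge d L) → Site d L)
    (hP : ∀ c ∈ S, c.1 ∈ ({((P c).1, (P c).2.1.1), ((P c).1.shift (P c).2.1.1, (P c).2.1.2),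
        ((P c).1.shift (P c).2.1.2, (P c).2.1.1), ((P c).1, (P c).2.1.2)} : Finset (Edge d L)))
    (hPs : ∀ c ∈ S, c.2.toFinset ⊆ Finset.univ \
      {((P c).1, (P c).2.1.1), ((P c).1.shift (P c).2.1.1, (P c).2.1.2),
        ((P c).1.shift (P c).2.1.2, (P c).2.1.1), ((P c).1, (P c).2.1.2)})
    (hY : ∀ c ∈ S, c.1.1 = Y c ∨ c.1.1.shift c.1.2 = Y c)
    (hqB : ∀ c ∈ S, ∀ e : Edge d L, e.1 = Y c ∨ e.1.shift e.2 = Y c → e ≠ c.1 →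
      ∀ (U : GaugeConfig d L G) (v : G), q c.1 (update U e v) = q c.1 U) :
    (S.length : ℝ) * (1 - 8 * r ^ 2 / N +
        2 * Real.log ((haarProbability G).real {g : G | ‖ρ g - 1‖ ≤ r}) / (((d : ℝ) - 1) * N * β)) ^ 2 / 2 ≤
      ∫ U, Real.exp (-β * wilsonAction ρ U) /
            (∫ W, Real.exp (-β * wilsonAction ρ W) ∂Measure.pi (fun _ : Edge d L => haarProbability G)) *
          Real.log ((Real.exp (-β * wilsonAction ρ U) /
              ∫ W, Real.exp (-β * wilsonAction ρ W) ∂Measure.pi (fun _ : Edge d L => haarProbability G)) /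
            ((l.map fun b => q b U).prod *
                coordAvg (haarProbability G) l.toFinset
                  (fun V : GaugeConfig d L G => Real.exp (-β * wilsonAction ρ V)) U /
              ∫ W, Real.exp (-β * wilsonAction ρ W) ∂Measure.pi (fun _ : Edge d L => haarProbability G)))
        ∂Measure.pi (fun _ : Edge d L => haarProbability G) := by
  set f : ℝ := 1 - 8 * r ^ 2 / N +
    2 * Real.log ((haarProbability G).real {g : G | ‖ρ g - 1‖ ≤ r}) / (((d : ℝ) - 1) * N * β) with hfdef
  have hmain := wilson_kl_arHybrid_ge_sum_sq_plaquette (d := d) (L := L) ρ hρ hL hω hω1 hne hβ hqm hcq hqlo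
    hqhi hq1 l hl hpw S hS P Y hP hPs hY hqB
  -- each witnessed term is at least `f²`
  have hterm : ∀ c ∈ S, f ^ 2 ≤ (wilsonExpectation ρ β (fun U : GaugeConfig d L G =>
      (N : ℝ)⁻¹ * (ρ (plaquetteHolonomy U (P c).1 (P c).2.1.1 (P c).2.1.2)).trace.re)) ^ 2 := by
    intro c hc
    have hkl : (P c).2.1.1 ≠ (P c).2.1.2 := ne_of_lt (P c).2.2
    have hfloor := wilsonExpectation_plaquette_ge_linkBall (d := d) (L := L) ρ hd hN hρ hρU hβ hr (P c).1 hkl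
    exact pow_le_pow_left₀ hf hfloor 2
  have hconst : (S.map fun _ => f ^ 2).sum = (S.length : ℝ) * f ^ 2 := by
    rw [List.map_const', List.sum_replicate, nsmul_eq_mul]
  have hle : (S.length : ℝ) * f ^ 2 ≤ (S.map fun c => (wilsonExpectation ρ β (fun U : GaugeConfig d L G =>
      (N : ℝ)⁻¹ * (ρ (plaquetteHolonomy U (P c).1 (P c).2.1.1 (P c).2.1.2)).trace.re)) ^ 2).sum := by
    rw [← hconst]
    exact List.sum_le_sum hterm
  linarith

end Wilson

end Summit.Ventures.LatticeQCDFlow.Theory2.Autoregressive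

end
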